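import Summits.RiemannHypothesis.RiemannHypothesis.Theorems.PfPersistenceEdgeLawCutArch
import Summits.RiemannHypothesis.RiemannHypothesis.Theorems.PfPersistenceEdgeLawCutMajorant
import Summits.RiemannHypothesis.RiemannHypothesis.Theorems.PfPersistenceEdgeLawCutProfiles
import Summits.RiemannHypothesis.RiemannHypothesis.Theorems.PfPersistenceEdgeLawCutFar
import Summits.RiemannHypothesis.RiemannHypothesis.Theorems.WeilWindowFlowWindowLipschitzStubCommutatorBoundAux4

/-!
# Edge law by cutting — the archimedean commutator of the steep cut (RH-free)

Part of the pub-rhpf THEORY-2 programme (mechanism / rigidity of the Weil window bottom; no RH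
claims). For a NORMALISED Weil ground state `u` of the window `a` (measurable, zero off `(−a, a)`,
pointwise edge law `‖u x‖² log(1/(a−|x|)) ≤ K_P` at depth `< d₀`) whose cumulative edge masses
obey `∫_{a−r<|x|} ‖u‖² ≤ I′ r / log(1/r)` for `0 < r ≤ r₀`, and the steep cutoff
`χ = steepCut (a − h) ℓ` (ramp of width `ℓ` ending at depth `h`; `H = h + ℓ`, `2H ≤ R ≤ r₀`,
`θ = R/(R − H)`), the archimedean commutator is bounded SHARPLY:

`∫₀^∞ ρ(t) ∫ (χ(x+t) − χ(x))² ‖u(x+t)‖ ‖u(x)‖ dx dt ≤ θ · I′ · H + cutArchErr`,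

where `cutArchErr = O(H/√log(1/H))` for fixed ratios `ℓ : h : R` (`cut_arch_bound`). The constant
`θ · I′ · H → I′ · h` as `ℓ/h → 0`, `R/h → ∞` is the kernel constant `2c₀ = 1` of the edge law.
Assembly of `cut_pointwise` (zones), `cut_arch_le` (integration), the profiles, the layer-cake
bound and the packaging of the far terms.

Sources: E. Bombieri, *Remarks on Weil's quadratic functional in the theory of prime numbers I*,
Rend. Mat. Acc. Lincei (9) 11 (2000) §4 (archimedean form); Cycon–Froese–Kirsch–Simon,
*Schrödinger Operators*, Thm 3.2 (IMS localisation); folklore measure theory.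
-/

set_option linter.dupNamespace false

noncomputable section

open MeasureTheory Set Filter
open scoped Topology ENNReal NNReal

namespace Summit.RiemannHypothesis.RiemannHypothesis.Theorems.PfPersistence

open Literature.NumberTheory.LFunctions
open Summit.RiemannHypothesis.RiemannHypothesis.Theorems.WeilWindowFlowWindowLipschitz

/-- The error term of the sharp archimedean cut bound (`H = h + ℓ`, `θ = R/(R−H)`,
`L_s = log(1/s)`): `θH/(2√L_H)·(g(r₀) + I′/(2√L_{r₀})) + 4 H K_P (log((R+ℓ)/ℓ) + R)/√(L_H L_R)`
`+ 2(1 + ρ(r₀/2))(a + 1/2)·(1 + I′/2)H/√L_H` — it is `o(h)` along `ℓ = ηh`, `R = κh`. -/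
def cutArchErr (a h ℓ R r₀ KP I' : ℝ) : ℝ :=
  R / (R - (h + ℓ)) * (h + ℓ) / (2 * Real.sqrt (Real.log (1 / (h + ℓ)))) *
      (cutFarWeight r₀ + I' / (2 * Real.sqrt (Real.log (1 / r₀)))) +
    4 * (h + ℓ) * KP * (Real.log ((R + ℓ) / ℓ) + R) /
      Real.sqrt (Real.log (1 / (h + ℓ)) * Real.log (1 / R)) +
    2 * (1 + weilArchDensity (r₀ / 2)) * (a + 1 / 2) *
      ((1 + I' / 2) * (h + ℓ) / Real.sqrt (Real.log (1 / (h + ℓ))))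

/-- **The `L¹` norm on the edge layer.** If `u` vanishes off `(−a, a)` and its edge mass obeys
`m(H) = ∫_{a−H<|x|} ‖u‖² ≤ I′H/log(1/H)` (`0 < H < 1`), then
`∫_{a−H<|x|} ‖u‖ ≤ (1 + I′/2) H/√log(1/H)` (AM–GM `‖u‖ ≤ (λ + ‖u‖²/λ)/2` on the layer, of
measure `≤ 2H`, with `λ = 1/√log(1/H)`). -/
theorem cut_layer_norm_le {u : ℝ → ℂ} {a H I' : ℝ} (hu2 : Integrable fun x ↦ ‖u x‖ ^ 2)
    (hu0 : ∀ x, x ∉ Ioo (-a) a → u x = 0) (hH : 0 < H) (hH1 : H < 1)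
    (hmH : ∫ x in {x : ℝ | a - H < |x|}, ‖u x‖ ^ 2 ≤ I' * H / Real.log (1 / H)) :
    ∫ x in {x : ℝ | a - H < |x|}, ‖u x‖ ≤ (1 + I' / 2) * H / Real.sqrt (Real.log (1 / H)) := by
  have hLH : 0 < Real.log (1 / H) := stub_surplusReduction_log_pos hH hH1
  have hLHsq : Real.log (1 / H) = Real.sqrt (Real.log (1 / H)) ^ 2 := (Real.sq_sqrt hLH.le).symm
  set sH := Real.sqrt (Real.log (1 / H)) with hsHdef
  have hsH : 0 < sH := Real.sqrt_pos.2 hLH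
  have hLaym : MeasurableSet {x : ℝ | a - H < |x|} := stub_commutatorBound_measurableSet_layer a H
  set T : Set ℝ := {x : ℝ | a - H < |x| ∧ |x| ≤ a - 0} with hTdef
  have hTm : MeasurableSet T := by
    rw [hTdef, setOf_and]
    exact (measurableSet_lt measurable_const continuous_abs.measurable).inter
      (measurableSet_le continuous_abs.measurable measurable_const)
  have hTsub : T ⊆ Icc (-a) a := fun y hy ↦ abs_le.1 (hy.2.trans (sub_zero a).le)
  have hTfin : volume T ≠ ⊤ := ((measure_mono hTsub).trans_lt measure_Icc_lt_top).ne
  have hTvol : volume.real T ≤ 2 * H := by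
    calc volume.real T ≤ 2 * max (H - 0) 0 := stub_commutatorBound_volume_real_shell_le a 0 H
      _ = 2 * H := by rw [sub_zero, max_eq_left hH.le]
  have hsub : ∀ x ∈ {x : ℝ | a - H < |x|}, u x ≠ 0 → x ∈ T := by
    intro x hx hux
    have hxI : x ∈ Ioo (-a) a := by
      by_contra hc
      exact hux (hu0 x hc)
    exact ⟨hx, by rw [sub_zero]; exact (abs_lt.2 ⟨hxI.1, hxI.2⟩).le⟩
  have h1 := stub_commutatorBound_setIntegral_norm_le hLaym hTm hTfin hsub hu2.integrableOn
    (l := 1 / sH) (by positivity)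
  calc ∫ x in {x : ℝ | a - H < |x|}, ‖u x‖ ≤ _ := h1
    _ ≤ (1 / sH * (2 * H) + (I' * H / Real.log (1 / H)) / (1 / sH)) / 2 := by gcongr
    _ = (1 + I' / 2) * H / sH := by
        rw [hLHsq]
        field_simp

set_option maxHeartbeats 800000 in
/-- **The sharp archimedean cut bound.** See the module docstring. -/
theorem cut_arch_bound {u : ℝ → ℂ} {a h ℓ R r₀ d₀ KP I' : ℝ} (hum : Measurable u)
    (hu : IsWeilGroundState a u) (hu0 : ∀ x, x ∉ Ioo (-a) a → u x = 0)
    (hP : ∀ x, 0 < a - |x| → a - |x| < d₀ → ‖u x‖ ^ 2 * Real.log (1 / (a - |x|)) ≤ KP)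
    (hB : ∀ r, 0 < r → r ≤ r₀ →
      ∫ x in {x : ℝ | a - r < |x|}, ‖u x‖ ^ 2 ≤ I' * r / Real.log (1 / r))
    (hh : 0 < h) (hℓ : 0 < ℓ) (hHR : 2 * (h + ℓ) ≤ R) (hRr : R ≤ r₀) (hrd : r₀ ≤ d₀) (hd1 : d₀ < 1)
    (hra : 2 * r₀ ≤ a) (hKP : 0 ≤ KP) (hI : 0 ≤ I') :
    ∫ t in Ioi (0 : ℝ), weilArchDensity t *
        ∫ x, (steepCut (a - h) ℓ (x + t) - steepCut (a - h) ℓ x) ^ 2 * (‖u (x + t)‖ * ‖u x‖) ≤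
      R / (R - (h + ℓ)) * I' * (h + ℓ) + cutArchErr a h ℓ R r₀ KP I' := by
  unfold cutArchErr
  -- parameters
  have hH : 0 < h + ℓ := by positivity
  have hHR' : h + ℓ < R := by linarith
  have hR : 0 < R := by linarith
  have hr0 : 0 < r₀ := by linarith
  have hr1 : r₀ < 1 := by linarith
  have hR1 : R ≤ 1 := by linarith
  have hH1 : h + ℓ < 1 := by linarith
  have ha : 0 < a := hu.pos
  have hHa : h + ℓ ≤ a := by linarith
  have hLH : 0 < Real.log (1 / (h + ℓ)) := stub_surplusReduction_log_pos hH hH1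
  have hLR : 0 < Real.log (1 / R) := stub_surplusReduction_log_pos hR (by linarith)
  have hLr : 0 < Real.log (1 / r₀) := stub_surplusReduction_log_pos hr0 hr1
  have hLRH : Real.log (1 / R) ≤ Real.log (1 / (h + ℓ)) := log_one_div_antitone hH hHR'.le
  have hLrR : Real.log (1 / r₀) ≤ Real.log (1 / R) := log_one_div_antitone hR hRr
  have hLHsq : Real.log (1 / (h + ℓ)) = Real.sqrt (Real.log (1 / (h + ℓ))) ^ 2 :=
    (Real.sq_sqrt hLH.le).symm
  set sH := Real.sqrt (Real.log (1 / (h + ℓ))) with hsHdef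
  set sR := Real.sqrt (Real.log (1 / R)) with hsRdef
  set sr := Real.sqrt (Real.log (1 / r₀)) with hsrdef
  have hsH : 0 < sH := Real.sqrt_pos.2 hLH
  have hsR : 0 < sR := Real.sqrt_pos.2 hLR
  have hsr : 0 < sr := Real.sqrt_pos.2 hLr
  have hsRH : sR ≤ sH := Real.sqrt_le_sqrt hLRH
  have hsrR : sr ≤ sR := Real.sqrt_le_sqrt hLrR
  set θ := R / (R - (h + ℓ)) with hθdef
  have hθ0 : 0 ≤ θ := div_nonneg hR.le (by linarith)
  set cV : ℝ := 1 + weilArchDensity (r₀ / 2) with hcVdef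
  have hcV0 : 0 ≤ cV := by
    have := weilArchDensity_pos (show 0 < r₀ / 2 by positivity)
    rw [hcVdef]; linarith
  set e₀ : ℝ := KP / Real.sqrt (Real.log (1 / (h + ℓ)) * Real.log (1 / R)) with he₀def
  have he₀0 : 0 ≤ e₀ := by positivity
  set β : ℝ := sH * θ * (sR - sr) / 2 with hβdef
  have hβ0 : 0 ≤ β := by
    have : 0 ≤ sR - sr := by linarith
    positivity
  -- data on `u`
  have hu0' : ∀ x, x ∉ Icc (-a) a → u x = 0 := fun x hx ↦ hu0 x fun h' ↦ hx (Ioo_subset_Icc_self h')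
  have hui : Integrable u := hu.integrable
  have hu2 : Integrable fun x ↦ ‖u x‖ ^ 2 := (memLp_two_iff_integrable_sq_norm hu.memLp.1).1 hu.memLp
  have hnorm : ∫ x, ‖u x‖ ^ 2 = 1 := hu.integral_norm_sq
  have hL1 : ∫ x, ‖u x‖ ≤ a + 1 / 2 := by
    have := stub_commutatorBound_norm_one_le ha.le hu0' hu2
    rw [hnorm] at this
    linarith
  have hmH : ∫ x in {x : ℝ | a - (h + ℓ) < |x|}, ‖u x‖ ^ 2 ≤ I' * (h + ℓ) / Real.log (1 / (h + ℓ)) :=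
    hB (h + ℓ) hH (by linarith)
  have hmsl : Measurable fun s : ℝ ↦ Real.sqrt (Real.log (1 / s)) :=
    Real.continuous_sqrt.measurable.comp (Real.measurable_log.comp (measurable_const.div measurable_id))
  -- the functions of the majorant
  set S : Set ℝ := {y : ℝ | a - (h + ℓ) < |y| ∧ |y| < a} with hSdef
  set Lay : Set ℝ := {y : ℝ | a - (h + ℓ) < |y|} with hLaydef
  set e : ℝ → ℝ := S.indicator (fun _ ↦ e₀) with hedef
  set c : ℝ → ℝ := cutNearCoeff ℓ R with hcdef
  set f : ℝ → ℝ := Lay.indicator (fun y ↦ ‖u y‖) with hfdef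
  set V : ℝ → ℝ := fun x ↦ cV * ‖u x‖ with hVdef
  set A₁ : ℝ → ℝ := (Ioo (a - (h + ℓ)) a).indicator (fun y ↦ ‖u y‖ ^ 2) with hA₁def
  set A₂ : ℝ → ℝ := (Icc (a - r₀) (a - R)).indicator
    (fun y ↦ ‖u y‖ ^ 2 * Real.sqrt (Real.log (1 / (a - y)))) with hA₂def
  set A₃ : ℝ → ℝ := (Ioo (-a) (-a + (h + ℓ))).indicator (fun y ↦ ‖u y‖ ^ 2) with hA₃def
  set A₄ : ℝ → ℝ := (Icc (-a + R) (-a + r₀)).indicator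
    (fun y ↦ ‖u y‖ ^ 2 * Real.sqrt (Real.log (1 / (a + y)))) with hA₄def
  set B₁ : ℝ → ℝ → ℝ := fun t y ↦ (Icc R r₀).indicator
    (fun s ↦ sH / (4 * t * Real.sqrt (Real.log (1 / s)))) (a - y) with hB₁def
  set B₂ : ℝ → ℝ → ℝ := fun t y ↦ (Ioo (a - (h + ℓ)) a).indicator 1 y / (4 * t * sH) with hB₂def
  set B₃ : ℝ → ℝ → ℝ := fun t y ↦ (Icc R r₀).indicator
    (fun s ↦ sH / (4 * t * Real.sqrt (Real.log (1 / s)))) (a + y) with hB₃def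
  set B₄ : ℝ → ℝ → ℝ := fun t y ↦ (Ioo (-a) (-a + (h + ℓ))).indicator 1 y / (4 * t * sH)
    with hB₄def
  set Ψ₂ : ℝ → ℝ := fun x ↦ θ * (h + ℓ) / (4 * (a - x) * sH) with hΨ₂def
  set Ψ₄ : ℝ → ℝ := fun p ↦ θ * (h + ℓ) / (4 * (a + p) * sH) with hΨ₄def
  -- measurability
  have hSm : MeasurableSet S := by
    rw [hSdef, setOf_and]
    exact (measurableSet_lt measurable_const continuous_abs.measurable).inter
      (measurableSet_lt continuous_abs.measurable measurable_const)
  have hLaym : MeasurableSet Lay := stub_commutatorBound_measurableSet_layer a (h + ℓ)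
  have hem : Measurable e := measurable_const.indicator hSm
  have hcm : Measurable c := measurable_cutNearCoeff ℓ R
  have hfm : Measurable f := hum.norm.indicator hLaym
  have hVm : Measurable V := hum.norm.const_mul cV
  have hA₁m : Measurable A₁ := (hum.norm.pow_const 2).indicator measurableSet_Ioo
  have hA₂m : Measurable A₂ :=
    ((hum.norm.pow_const 2).mul (hmsl.comp (measurable_const.sub measurable_id))).indicator
      measurableSet_Icc
  have hA₃m : Measurable A₃ := (hum.norm.pow_const 2).indicator measurableSet_Ioo
  have hA₄m : Measurable A₄ :=
    ((hum.norm.pow_const 2).mul (hmsl.comp (measurable_const.add measurable_id))).indicator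
      measurableSet_Icc
  have hB₁m : Measurable (Function.uncurry B₁) := by
    show Measurable fun q : ℝ × ℝ ↦ (Icc R r₀).indicator
      (fun s ↦ sH / (4 * q.1 * Real.sqrt (Real.log (1 / s)))) (a - q.2)
    simp only [Set.indicator_apply]
    refine Measurable.ite ?_ ?_ measurable_const
    · exact (measurable_const.sub measurable_snd) measurableSet_Icc
    · exact measurable_const.div ((measurable_const.mul measurable_fst).mul
        (hmsl.comp (measurable_const.sub measurable_snd)))
  have hB₂m : Measurable (Function.uncurry B₂) := by
    show Measurable fun q : ℝ × ℝ ↦ (Ioo (a - (h + ℓ)) a).indicator 1 q.2 / (4 * q.1 * sH)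
    exact ((measurable_one.indicator measurableSet_Ioo).comp measurable_snd).div
      ((measurable_const.mul measurable_fst).mul measurable_const)
  have hB₃m : Measurable (Function.uncurry B₃) := by
    show Measurable fun q : ℝ × ℝ ↦ (Icc R r₀).indicator
      (fun s ↦ sH / (4 * q.1 * Real.sqrt (Real.log (1 / s)))) (a + q.2)
    simp only [Set.indicator_apply]
    refine Measurable.ite ?_ ?_ measurable_const
    · exact (measurable_const.add measurable_snd) measurableSet_Icc
    · exact measurable_const.div ((measurable_const.mul measurable_fst).mul
        (hmsl.comp (measurable_const.add measurable_snd)))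
  have hB₄m : Measurable (Function.uncurry B₄) := by
    show Measurable fun q : ℝ × ℝ ↦ (Ioo (-a) (-a + (h + ℓ))).indicator 1 q.2 / (4 * q.1 * sH)
    exact ((measurable_one.indicator measurableSet_Ioo).comp measurable_snd).div
      ((measurable_const.mul measurable_fst).mul measurable_const)
  -- signs
  have he0 : ∀ x, 0 ≤ e x := fun x ↦ indicator_nonneg (fun _ _ ↦ he₀0) x
  have hc0 : ∀ t, 0 ≤ c t := cutNearCoeff_nonneg ℓ R
  have hf0 : ∀ x, 0 ≤ f x := fun x ↦ indicator_nonneg (fun _ _ ↦ norm_nonneg _) x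
  have hV0 : ∀ x, 0 ≤ V x := fun x ↦ mul_nonneg hcV0 (norm_nonneg _)
  have hA₁0 : ∀ x, 0 ≤ A₁ x := fun x ↦ indicator_nonneg (fun _ _ ↦ by positivity) x
  have hA₂0 : ∀ x, 0 ≤ A₂ x := fun x ↦ indicator_nonneg (fun _ _ ↦ by positivity) x
  have hA₃0 : ∀ x, 0 ≤ A₃ x := fun x ↦ indicator_nonneg (fun _ _ ↦ by positivity) x
  have hA₄0 : ∀ x, 0 ≤ A₄ x := fun x ↦ indicator_nonneg (fun _ _ ↦ by positivity) x
  -- integrability and the values of the four scalar integrals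
  have hSsub : S ⊆ Icc (-a) a := fun y hy ↦ abs_le.1 hy.2.le
  have hSfin : volume S ≠ ⊤ := ((measure_mono hSsub).trans_lt measure_Icc_lt_top).ne
  have hei : Integrable e := (integrable_indicator_iff hSm).2 (integrableOn_const (hs := hSfin))
  obtain ⟨hci, hcint⟩ := integral_cutNearCoeff_le hℓ hR hR1
  have hfi : Integrable f := hui.norm.indicator hLaym
  have hVi : Integrable V := hui.norm.const_mul cV
  have hSvol : volume.real S ≤ 2 * (h + ℓ) := by
    have h1 : S ⊆ {x : ℝ | a - (h + ℓ) < |x| ∧ |x| ≤ a - 0} :=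
      fun y hy ↦ ⟨hy.1, by linarith [hy.2]⟩
    have h2 : {x : ℝ | a - (h + ℓ) < |x| ∧ |x| ≤ a - 0} ⊆ Icc (-a) a :=
      fun y hy ↦ abs_le.1 (hy.2.trans (sub_zero a).le)
    calc volume.real S ≤ volume.real {x : ℝ | a - (h + ℓ) < |x| ∧ |x| ≤ a - 0} :=
          measureReal_mono h1 ((measure_mono h2).trans_lt measure_Icc_lt_top).ne
      _ ≤ 2 * max (h + ℓ - 0) 0 := stub_commutatorBound_volume_real_shell_le a 0 (h + ℓ)
      _ = 2 * (h + ℓ) := by rw [sub_zero, max_eq_left hH.le]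
  have hinte : ∫ x, e x ≤ 2 * (h + ℓ) * e₀ := by
    rw [hedef, integral_indicator_const e₀ hSm, smul_eq_mul]
    exact mul_le_mul_of_nonneg_right hSvol he₀0
  have hintV : ∫ x, V x ≤ cV * (a + 1 / 2) := by
    rw [hVdef, integral_const_mul]
    exact mul_le_mul_of_nonneg_left hL1 hcV0
  have hintf : ∫ x, f x ≤ (1 + I' / 2) * (h + ℓ) / sH := by
    rw [hfdef, integral_indicator hLaym]
    exact cut_layer_norm_le hu2 hu0 hH hH1 hmH
  -- the pointwise majorant and the integration
  have hc : ∀ t, 0 < t → t ≤ R → weilArchDensity t * min 1 (t ^ 2 / ℓ ^ 2) ≤ c t := by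
    intro t ht htR
    rw [hcdef, cutNearCoeff, indicator_of_mem (show t ∈ Ioc 0 R from ⟨ht, htR⟩)]
  have hbound := cut_pointwise hh hℓ hHR hRr hrd hd1 hra hKP hu0 hP hc0 hc
  have hΨ₁ : ∀ p, A₁ p ≠ 0 →
      ∫⁻ t in Ioi (0 : ℝ), ENNReal.ofReal (B₁ t (p - t)) ≤ ENNReal.ofReal β := by
    intro p hp
    have hpI : p ∈ Ioo (a - (h + ℓ)) a := by
      by_contra hc'
      exact hp (indicator_of_notMem hc' _)
    exact cut_profile_far_right hsH.le (by linarith [hpI.2]) (by linarith [hpI.1]) hHR' hRr hr1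
  have hΨ₂ : ∀ x, A₂ x ≠ 0 →
      ∫⁻ t in Ioi (0 : ℝ), ENNReal.ofReal (B₂ t (x + t)) ≤ ENNReal.ofReal (Ψ₂ x) := by
    intro x hx
    have hxI : x ∈ Icc (a - r₀) (a - R) := by
      by_contra hc'
      exact hx (indicator_of_notMem hc' _)
    exact cut_profile_shallow_right hH.le hHR' (by linarith [hxI.2]) hsH
  have hΨ₃ : ∀ x, A₃ x ≠ 0 →
      ∫⁻ t in Ioi (0 : ℝ), ENNReal.ofReal (B₃ t (x + t)) ≤ ENNReal.ofReal β := by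
    intro x hx
    have hxI : x ∈ Ioo (-a) (-a + (h + ℓ)) := by
      by_contra hc'
      exact hx (indicator_of_notMem hc' _)
    exact cut_profile_far_left hsH.le (by linarith [hxI.1]) (by linarith [hxI.2]) hHR' hRr hr1
  have hΨ₄ : ∀ p, A₄ p ≠ 0 →
      ∫⁻ t in Ioi (0 : ℝ), ENNReal.ofReal (B₄ t (p - t)) ≤ ENNReal.ofReal (Ψ₄ p) := by
    intro p hp
    have hpI : p ∈ Icc (-a + R) (-a + r₀) := by
      by_contra hc'
      exact hp (indicator_of_notMem hc' _)
    exact cut_profile_shallow_left hH.le hHR' (by linarith [hpI.1]) hsH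
  have key := cut_arch_le (ρ := weilArchDensity)
    (Kf := fun t x ↦ (steepCut (a - h) ℓ (x + t) - steepCut (a - h) ℓ x) ^ 2 *
      (‖u (x + t)‖ * ‖u x‖))
    (c := c) (e := e) (f := f) (V := V) (A₁ := A₁) (A₂ := A₂) (A₃ := A₃) (A₄ := A₄)
    (Ψ₁ := fun _ ↦ β) (Ψ₂ := Ψ₂) (Ψ₃ := fun _ ↦ β) (Ψ₄ := Ψ₄)
    (B₁ := B₁) (B₂ := B₂) (B₃ := B₃) (B₄ := B₄)
    hcm hem hfm hVm hA₁m hA₂m hA₃m hA₄m hB₁m hB₂m hB₃m hB₄m hc0 he0 hf0 hV0 hA₁0 hA₂0 hA₃0 hA₄0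
    hci hei hfi hVi hΨ₁ hΨ₂ hΨ₃ hΨ₄ hbound
  -- the far terms
  have hfar1 := cut_far_shallow_le (a := a) (H := h + ℓ) (β := β) hu2 hβ0 hHa
  have hfar2 := cut_far_deep_le (a := a) (κ := θ * (h + ℓ)) (N := sH) hum hu2 hR hRr hr1 hI hB
    hra (by positivity) hsH
  -- collect in `ℝ≥0∞`, then pass to `ℝ`
  set X : ℝ := 2 * (∫ t, c t) * (∫ x, e x) + 2 * (∫ x, V x) * (∫ x, f x) with hXdef
  set Y₁ : ℝ := β * ∫ x in {x : ℝ | a - (h + ℓ) < |x|}, ‖u x‖ ^ 2 with hY₁def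
  set Y₂ : ℝ := θ * (h + ℓ) / (2 * sH) * (cutFarWeight r₀ * (∫ x, ‖u x‖ ^ 2) +
    I' * ((sR - sr) + (1 / (2 * sr) - 1 / (2 * sR)))) with hY₂def
  have hintc0 : 0 ≤ ∫ t, c t := integral_nonneg hc0
  have hinte0 : 0 ≤ ∫ x, e x := integral_nonneg he0
  have hintV0 : 0 ≤ ∫ x, V x := integral_nonneg hV0
  have hintf0 : 0 ≤ ∫ x, f x := integral_nonneg hf0
  have hX0 : 0 ≤ X := by positivity
  have hY₁0 : 0 ≤ Y₁ := mul_nonneg hβ0 (integral_nonneg fun _ ↦ by positivity)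
  have hdiff0 : 0 ≤ (sR - sr) + (1 / (2 * sr) - 1 / (2 * sR)) := by
    have h1 : 0 ≤ sR - sr := by linarith
    have h2 : 1 / (2 * sR) ≤ 1 / (2 * sr) := one_div_le_one_div_of_le (by positivity) (by linarith)
    linarith
  have hg0 : 0 ≤ cutFarWeight r₀ := cutFarWeight_nonneg hr0
  have hY₂0 : 0 ≤ Y₂ := by
    have : 0 ≤ cutFarWeight r₀ * (∫ x, ‖u x‖ ^ 2) + I' * ((sR - sr) + (1 / (2 * sr) - 1 / (2 * sR))) := by
      rw [hnorm]; positivity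
    positivity
  have hArchE : ENNReal.ofReal (∫ t in Ioi (0 : ℝ), weilArchDensity t *
        ∫ x, (steepCut (a - h) ℓ (x + t) - steepCut (a - h) ℓ x) ^ 2 * (‖u (x + t)‖ * ‖u x‖)) ≤
      ENNReal.ofReal (X + (Y₁ + Y₂)) := by
    calc _ ≤ _ := key
      _ = ENNReal.ofReal X +
          (((∫⁻ p, ENNReal.ofReal (A₁ p * β)) + ∫⁻ x, ENNReal.ofReal (A₃ x * β)) +
            ((∫⁻ x, ENNReal.ofReal (A₂ x * Ψ₂ x)) + ∫⁻ p, ENNReal.ofReal (A₄ p * Ψ₄ p))) := by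
          ring
      _ ≤ ENNReal.ofReal X + (ENNReal.ofReal Y₁ + ENNReal.ofReal Y₂) :=
          add_le_add le_rfl (add_le_add hfar1 hfar2)
      _ = ENNReal.ofReal (X + (Y₁ + Y₂)) := by
          rw [← ENNReal.ofReal_add hY₁0 hY₂0, ← ENNReal.ofReal_add hX0 (add_nonneg hY₁0 hY₂0)]
  have hArch : ∫ t in Ioi (0 : ℝ), weilArchDensity t *
        ∫ x, (steepCut (a - h) ℓ (x + t) - steepCut (a - h) ℓ x) ^ 2 * (‖u (x + t)‖ * ‖u x‖) ≤
      X + (Y₁ + Y₂) := (ENNReal.ofReal_le_ofReal_iff (by positivity)).1 hArchE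
  -- real bounds of `X`, `Y₁`, `Y₂`
  have hlog0 : 0 ≤ Real.log ((R + ℓ) / ℓ) := Real.log_nonneg (by rw [le_div_iff₀ hℓ]; linarith)
  have hX : X ≤ 4 * (h + ℓ) * KP * (Real.log ((R + ℓ) / ℓ) + R) /
        Real.sqrt (Real.log (1 / (h + ℓ)) * Real.log (1 / R)) +
      2 * cV * (a + 1 / 2) * ((1 + I' / 2) * (h + ℓ) / sH) := by
    have h1 : 2 * (∫ t, c t) * (∫ x, e x) ≤ 2 * (Real.log ((R + ℓ) / ℓ) + R) * (2 * (h + ℓ) * e₀) :=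
      mul_le_mul (mul_le_mul_of_nonneg_left hcint zero_le_two) hinte hinte0
        (mul_nonneg zero_le_two (add_nonneg hlog0 hR.le))
    have h2 : 2 * (∫ x, V x) * (∫ x, f x) ≤ 2 * (cV * (a + 1 / 2)) * ((1 + I' / 2) * (h + ℓ) / sH) :=
      mul_le_mul (mul_le_mul_of_nonneg_left hintV zero_le_two) hintf hintf0 (by positivity)
    have h3 : 2 * (Real.log ((R + ℓ) / ℓ) + R) * (2 * (h + ℓ) * e₀) =
        4 * (h + ℓ) * KP * (Real.log ((R + ℓ) / ℓ) + R) /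
          Real.sqrt (Real.log (1 / (h + ℓ)) * Real.log (1 / R)) := by
      rw [he₀def]
      ring
    rw [hXdef]
    linarith
  have hY₁ : Y₁ ≤ θ * I' * (h + ℓ) / 2 := by
    have h1 : β ≤ sH * θ * sR / 2 := by
      rw [hβdef]
      have : sH * θ * (sR - sr) ≤ sH * θ * sR :=
        mul_le_mul_of_nonneg_left (by linarith) (by positivity)
      linarith
    calc Y₁ ≤ β * (I' * (h + ℓ) / Real.log (1 / (h + ℓ))) := mul_le_mul_of_nonneg_left hmH hβ0
      _ ≤ sH * θ * sR / 2 * (I' * (h + ℓ) / Real.log (1 / (h + ℓ))) :=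
          mul_le_mul_of_nonneg_right h1 (by positivity)
      _ = θ * I' * (h + ℓ) / 2 * (sR / sH) := by
          rw [hLHsq]
          field_simp
      _ ≤ θ * I' * (h + ℓ) / 2 * 1 :=
          mul_le_mul_of_nonneg_left ((div_le_one hsH).2 hsRH) (by positivity)
      _ = θ * I' * (h + ℓ) / 2 := mul_one _
  have hY₂ : Y₂ ≤ θ * I' * (h + ℓ) / 2 +
      θ * (h + ℓ) / (2 * sH) * (cutFarWeight r₀ + I' / (2 * sr)) := by
    have h1 : cutFarWeight r₀ * (∫ x, ‖u x‖ ^ 2) + I' * ((sR - sr) + (1 / (2 * sr) - 1 / (2 * sR))) ≤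
        cutFarWeight r₀ + I' / (2 * sr) + I' * sR := by
      rw [hnorm, mul_one]
      have hD : (sR - sr) + (1 / (2 * sr) - 1 / (2 * sR)) ≤ sR + 1 / (2 * sr) := by
        have h1 : 0 ≤ 1 / (2 * sR) := by positivity
        linarith [hsr.le]
      have h2 := mul_le_mul_of_nonneg_left hD hI
      have h3 : I' * (sR + 1 / (2 * sr)) = I' * sR + I' / (2 * sr) := by ring
      linarith
    have h2 : θ * (h + ℓ) / (2 * sH) * (I' * sR) ≤ θ * I' * (h + ℓ) / 2 := by
      calc θ * (h + ℓ) / (2 * sH) * (I' * sR) = θ * I' * (h + ℓ) / 2 * (sR / sH) := by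
            field_simp
        _ ≤ θ * I' * (h + ℓ) / 2 * 1 :=
            mul_le_mul_of_nonneg_left ((div_le_one hsH).2 hsRH) (by positivity)
        _ = θ * I' * (h + ℓ) / 2 := mul_one _
    calc Y₂ ≤ θ * (h + ℓ) / (2 * sH) * (cutFarWeight r₀ + I' / (2 * sr) + I' * sR) :=
          mul_le_mul_of_nonneg_left h1 (by positivity)
      _ = θ * (h + ℓ) / (2 * sH) * (cutFarWeight r₀ + I' / (2 * sr)) +
          θ * (h + ℓ) / (2 * sH) * (I' * sR) := by ring
      _ ≤ _ := by linarith
  -- conclusion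
  have hE1 : θ * (h + ℓ) / (2 * sH) * (cutFarWeight r₀ + I' / (2 * sr)) =
      R / (R - (h + ℓ)) * (h + ℓ) / (2 * sH) * (cutFarWeight r₀ + I' / (2 * sr)) := by
    rw [hθdef]
  have hE3 : 2 * cV * (a + 1 / 2) * ((1 + I' / 2) * (h + ℓ) / sH) =
      2 * (1 + weilArchDensity (r₀ / 2)) * (a + 1 / 2) * ((1 + I' / 2) * (h + ℓ) / sH) := by
    rw [hcVdef]
  have hmain : θ * I' * (h + ℓ) = R / (R - (h + ℓ)) * I' * (h + ℓ) := by rw [hθdef]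
  linarith [hArch, hX, hY₁, hY₂]

end Summit.RiemannHypothesis.RiemannHypothesis.Theorems.PfPersistence

end
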